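import Summits.CriticalPhenomena.Ising3DConformalLimit.Theorems.HyperoctahedralRPExistsScaleCovariantLimitFunnelDoublingIffAxisRate
import HarnessLib

/-!
# Line `folded-current-repulsion`, engine F2 (= item 6150): the √n-doubling partial — real-variable core

Lead `prover-line-stmt-CriticalPhenomena-1981-c15-0` (crux `ExistsScaleCovariantLimit`, stmt-CriticalPhenomena-1981), registered
sub-goal `level_le_of_octave_loss`. Item 6150 `TwoPointDoubling` asks `g(2n) ≥ κ g(n)` with ONE `κ > 0` at every scale,
`g(n) = ⟨σ₀σ_{ne₀}⟩_{β_c(3)}`; the trivial every-scale bound from the envelopes `c n⁻² ≤ g ≤ C n⁻¹` is `g(2n) ≥ (c/4C) n⁻¹ g(n)`.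
The √n-doubling theorem (assembled in `…FoldedCurrentSqrtDoubling.lean`) improves the every-scale loss to `n^{-1/2}`:
`g(2n) ≥ c' n^{-1/2} g(n)` for all `n ≥ 1`, by combining reflection positivity (log-convexity of the axis function) with the
Duminil-Copin–Panis lower bound (Theorem 1.3 of arXiv:2404.05700, in tree). This file is the model-free half, for an abstract
positive sequence `G` with nondecreasing shifted ratios `k ↦ G(k+2)/G(k+1)`, nonincreasing values and level envelope `k·G(k) ≤ C`:

* `first_ratio_pow_le`: `(G(n+1)/G(n))ⁿ · G(n) ≤ G(2n)`;
* `ratio_block_le_half`: an OCTAVE LOSS `G(2n) ≤ 2^{-ℓ} G(n)` forces `(G(n+1)/G(n))^b ≤ 1/2` for every block length `b` with `bℓ ≥ n`;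
* `block_halving`: hence (given the descending iteration `logConvex_descend`, taken as a hypothesis here) moving up by `j` blocks
  below `n` at least halves `G` `j` times;
* `level_le_of_octave_loss` (registered): with `b = ⌊n/ℓ⌋ + 1` and `4ℓ ≤ ⌊n/ℓ⌋`, the level at `n` is exponentially small in `ℓ`:
  `n·G(n) ≤ 4Cℓ·2^{-ℓ}` (walk down `ℓ−1` blocks from `n` to a scale `k₀ ≥ 3n/(5ℓ)` and use the envelope there);
* `four_pow_le_of_octave_loss`: the abstract conclusion `4^ℓ ≤ (1555200 C²/c₁) n` from an `ℓ`-octave loss at a scale `n`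
  carrying a Duminil-Copin–Panis-type lower bound (descending iteration and head-sum bound taken as hypotheses);
* `octave_loss_arith`: the bookkeeping inequality that turns the DCP lower bound `c₁ ≤ g(2n)·(χ_{8n} + 2nΣ_{k≤4n} k g(k))`, the
  level bound, the head-sum bound `Σ_{k≤n} k g(k) ≤ 6Cb` and the tail bound into `c₁ ≤ C/n + K·C²·n·4^{-ℓ}`;
* small numerics (`sq_le_two_mul_two_pow`, `pow_four_le_mul_two_pow`, `sq_mul_eighth_pow_le`).

References: M. Aizenman, H. Duminil-Copin, Ann. Math. 194 (2021) = arXiv:1912.07973, Prop. 5.3, §5.5, Remark 5.10;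
H. Duminil-Copin, R. Panis, CMP 406 (2025) = arXiv:2404.05700, Theorem 1.3.
-/

noncomputable section

open Real Finset
open scoped BigOperators

namespace Summit.CriticalPhenomena.Ising3DConformalLimit.Cruxes.ExistsScaleCovariantLimit

namespace Funnel.LogConvexSeq

variable {G : ℕ → ℝ}

/-- `(G(n+1)/G(n))ⁿ · G(n) ≤ G(2n)` for `n ≥ 1` (each ratio above `n` is at least the one at `n`). [folklore] -/
theorem first_ratio_pow_le (hpos : ∀ n, 0 < G n) (hmono : Monotone fun k => G (k + 2) / G (k + 1))
    {n : ℕ} (hn : 1 ≤ n) : (G (n + 1) / G n) ^ n * G n ≤ G (2 * n) := by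
  have h := pow_mul_le_add hpos hmono hn n
  rw [show n - 1 + 2 = n + 1 by omega, show n - 1 + 1 = n by omega, ← two_mul] at h
  exact h

/-- **Octave loss forces block decay of the first ratio.** If `G(2n) ≤ 2^{-ℓ} G(n)` (`ℓ ≠ 0`, `n ≥ 1`), `G` is nonincreasing,
and `bℓ ≥ n`, then `(G(n+1)/G(n))^b ≤ 1/2`. [folklore] -/
theorem ratio_block_le_half (hpos : ∀ n, 0 < G n) (hmono : Monotone fun k => G (k + 2) / G (k + 1))
    (hanti : ∀ k, G (k + 1) ≤ G k) {n ℓ b : ℕ} (hn : 1 ≤ n) (hℓ : ℓ ≠ 0) (hb : n ≤ b * ℓ)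
    (hloss : G (2 * n) ≤ (1 / 2 : ℝ) ^ ℓ * G n) : (G (n + 1) / G n) ^ b ≤ 1 / 2 := by
  set r : ℝ := G (n + 1) / G n with hr
  have hr0 : 0 ≤ r := (div_pos (hpos _) (hpos _)).le
  have hr1 : r ≤ 1 := (div_le_one (hpos n)).2 (hanti n)
  -- `rⁿ ≤ 2^{-ℓ}`
  have hrn : r ^ n ≤ (1 / 2 : ℝ) ^ ℓ := by
    have h1 : r ^ n * G n ≤ (1 / 2 : ℝ) ^ ℓ * G n := (first_ratio_pow_le hpos hmono hn).trans hloss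
    exact le_of_mul_le_mul_right h1 (hpos n)
  -- `(r^b)^ℓ = r^{bℓ} ≤ rⁿ ≤ (1/2)^ℓ`
  have hbl : (r ^ b) ^ ℓ ≤ (1 / 2 : ℝ) ^ ℓ := by
    rw [← pow_mul]
    exact (pow_le_pow_of_le_one hr0 hr1 hb).trans hrn
  exact le_of_pow_le_pow_left₀ hℓ (by norm_num) hbl

/-- **Block halving below `n`.** Under the same hypotheses, and given the descending iteration
`G(k+s) ≤ (G(n+1)/G(n))^s G(k)` for `1 ≤ k`, `k + s ≤ n` (the tree lemma `logConvex_descend`, passed as a hypothesis),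
moving up by `j` blocks of length `b` below `n` halves `G` at least `j` times. [folklore] -/
theorem block_halving (hpos : ∀ n, 0 < G n) (hmono : Monotone fun k => G (k + 2) / G (k + 1))
    (hanti : ∀ k, G (k + 1) ≤ G k) {n ℓ b : ℕ} (hn : 1 ≤ n) (hℓ : ℓ ≠ 0) (hb : n ≤ b * ℓ)
    (hloss : G (2 * n) ≤ (1 / 2 : ℝ) ^ ℓ * G n)
    (hdesc : ∀ k s : ℕ, 1 ≤ k → k + s ≤ n → G (k + s) ≤ (G (n + 1) / G n) ^ s * G k) :
    ∀ k j : ℕ, 1 ≤ k → k + j * b ≤ n → G (k + j * b) ≤ (1 / 2 : ℝ) ^ j * G k := by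
  intro k j hk hkj
  have hhalf := ratio_block_le_half hpos hmono hanti hn hℓ hb hloss
  have hr0 : 0 ≤ (G (n + 1) / G n) ^ b := pow_nonneg (div_pos (hpos _) (hpos _)).le b
  calc G (k + j * b) ≤ (G (n + 1) / G n) ^ (j * b) * G k := hdesc k (j * b) hk hkj
    _ = ((G (n + 1) / G n) ^ b) ^ j * G k := by rw [mul_comm j b, pow_mul]
    _ ≤ (1 / 2 : ℝ) ^ j * G k :=
        mul_le_mul_of_nonneg_right (pow_le_pow_left₀ hr0 hhalf j) (hpos k).le

/-- **The level at an octave-loss scale is exponentially small** (registered sub-goal `level_le_of_octave_loss`, abstract form).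
For `G > 0` with level envelope `k·G(k) ≤ C` (`k ≥ 1`): if `4ℓ ≤ ⌊n/ℓ⌋`, `ℓ ≥ 1`, and moving up by `j` blocks of length
`b = ⌊n/ℓ⌋ + 1` below `n` halves `G` `j` times, then `n·G(n) ≤ 4Cℓ·2^{-ℓ}`. Proof: write `n = qℓ + m` (`q = ⌊n/ℓ⌋`, `m < ℓ`),
`k₀ := n − (ℓ−1)b ≥ q + 1 − ℓ ≥ 1`; then `G(n) ≤ 2^{1−ℓ} G(k₀) ≤ 2^{1−ℓ} C/k₀` and `n ≤ 2ℓ k₀`. [folklore] -/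
theorem level_le_of_octave_loss_abstract (hpos : ∀ n, 0 < G n) {C : ℝ} (henv : ∀ k : ℕ, 1 ≤ k → (k : ℝ) * G k ≤ C)
    {n ℓ : ℕ} (hℓ : 1 ≤ ℓ) (hq : 4 * ℓ ≤ n / ℓ)
    (hhalf : ∀ k j : ℕ, 1 ≤ k → k + j * (n / ℓ + 1) ≤ n → G (k + j * (n / ℓ + 1)) ≤ (1 / 2 : ℝ) ^ j * G k) :
    (n : ℝ) * G n ≤ 4 * C * ℓ * (1 / 2 : ℝ) ^ ℓ := by
  obtain ⟨l, rfl⟩ : ∃ l, ℓ = l + 1 := ⟨ℓ - 1, by omega⟩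
  set q : ℕ := n / (l + 1) with hqdef
  have hdm : (l + 1) * q + n % (l + 1) = n := Nat.div_add_mod n (l + 1)
  have hmod : n % (l + 1) < l + 1 := Nat.mod_lt _ (by omega)
  have hlq : l + 1 ≤ q := le_trans (by omega) hq
  -- `k₀ := n - l * (q + 1)`; first `l * (q + 1) ≤ n - 1`
  have hprod : l * (q + 1) + (q - l) = (l + 1) * q := by
    have hlq' : l ≤ q := by omega
    zify [hlq']
    ring
  have hk0le : l * (q + 1) + 1 ≤ n := by omega
  set k₀ : ℕ := n - l * (q + 1) with hk₀def
  have hk₀1 : 1 ≤ k₀ := by omega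
  have hk₀n : k₀ + l * (q + 1) = n := by omega
  have hk₀n' : k₀ + l * (n / (l + 1) + 1) ≤ n := by rw [← hqdef]; omega
  -- halving `l` times from `k₀` up to `n`
  have hG : G n ≤ (1 / 2 : ℝ) ^ l * G k₀ := by
    have h := hhalf k₀ l hk₀1 hk₀n'
    rw [hk₀n] at h
    exact h
  -- the envelope at `k₀` and `n ≤ 2 (l+1) k₀`
  have henv0 : (k₀ : ℝ) * G k₀ ≤ C := henv k₀ hk₀1
  have hk₀ge : q ≤ k₀ + l := by omega
  have hn2 : n ≤ 2 * (l + 1) * k₀ := by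
    -- `n < (q+1)(l+1)` and `k₀ ≥ q - l ≥ 3q/4`
    have h1 : n < (l + 1) * (q + 1) := by
      have := Nat.lt_succ_iff.2 (le_refl (n / (l + 1)))
      rw [← hqdef] at this
      have h := (Nat.div_lt_iff_lt_mul (by omega : 0 < l + 1)).1 this
      linarith [Nat.mul_comm (q + 1) (l + 1)]
    have h4 : 4 * (l + 1) ≤ q := hq
    nlinarith [h1, h4, hk₀ge]
  have hk₀pos : (0 : ℝ) < k₀ := by exact_mod_cast hk₀1
  have hn2' : (n : ℝ) ≤ 2 * ((l + 1 : ℕ) : ℝ) * k₀ := by exact_mod_cast hn2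
  have hhalfpow : (0 : ℝ) ≤ (1 / 2 : ℝ) ^ l := by positivity
  calc (n : ℝ) * G n ≤ (2 * ((l + 1 : ℕ) : ℝ) * k₀) * ((1 / 2 : ℝ) ^ l * G k₀) :=
        mul_le_mul hn2' hG (hpos n).le (by positivity)
    _ = 2 * ((l + 1 : ℕ) : ℝ) * (1 / 2 : ℝ) ^ l * ((k₀ : ℝ) * G k₀) := by ring
    _ ≤ 2 * ((l + 1 : ℕ) : ℝ) * (1 / 2 : ℝ) ^ l * C :=
        mul_le_mul_of_nonneg_left henv0 (by positivity)
    _ = 4 * C * ((l + 1 : ℕ) : ℝ) * (1 / 2 : ℝ) ^ (l + 1) := by rw [pow_succ]; ring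

/-! ### Small numerics -/

/-- `ℓ² ≤ 2·2^ℓ` for every natural `ℓ`. [folklore] -/
theorem sq_le_two_mul_two_pow (ℓ : ℕ) : (ℓ : ℝ) ^ 2 ≤ 2 * 2 ^ ℓ := by
  have key : ∀ m : ℕ, m ^ 2 ≤ 2 * 2 ^ m := by
    intro m
    induction m with
    | zero => norm_num
    | succ m ih =>
      have hm : m < 2 ^ m := Nat.lt_two_pow_self
      calc (m + 1) ^ 2 = m ^ 2 + 2 * m + 1 := by ring
        _ ≤ 2 * 2 ^ m + 2 * 2 ^ m := by linarith
        _ = 2 * 2 ^ (m + 1) := by ring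
  exact_mod_cast key ℓ

/-- `ℓ⁴ ≤ 24·2^ℓ` for every natural `ℓ`. [folklore] -/
theorem pow_four_le_mul_two_pow (ℓ : ℕ) : (ℓ : ℝ) ^ 4 ≤ 24 * 2 ^ ℓ := by
  have key : ∀ m : ℕ, m ^ 4 ≤ 24 * 2 ^ m := by
    intro m
    induction m with
    | zero => norm_num
    | succ m ih =>
      rcases Nat.lt_or_ge m 6 with hm | hm
      · interval_cases m <;> norm_num
      · -- `(m+1)^4 ≤ 2 m^4` for `m ≥ 6`
        have h2 : (m + 1) ^ 4 ≤ 2 * m ^ 4 := by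
          have h6 : 6 ≤ m := hm
          nlinarith [h6, Nat.zero_le m, pow_pos (show 0 < m by omega) 2, pow_pos (show 0 < m by omega) 3]
        calc (m + 1) ^ 4 ≤ 2 * m ^ 4 := h2
          _ ≤ 2 * (24 * 2 ^ m) := by omega
          _ = 24 * 2 ^ (m + 1) := by ring
  exact_mod_cast key ℓ

/-- `ℓ²·8^{-ℓ} ≤ 2·4^{-ℓ}` (from `ℓ² ≤ 2·2^ℓ`). [folklore] -/
theorem sq_mul_eighth_pow_le (ℓ : ℕ) : (ℓ : ℝ) ^ 2 * (1 / 8 : ℝ) ^ ℓ ≤ 2 * (1 / 4 : ℝ) ^ ℓ := by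
  have h := sq_le_two_mul_two_pow ℓ
  have h8 : (1 / 8 : ℝ) ^ ℓ = (1 / 2 : ℝ) ^ ℓ * (1 / 4 : ℝ) ^ ℓ := by rw [← mul_pow]; norm_num
  have h2 : (2 : ℝ) ^ ℓ * (1 / 2 : ℝ) ^ ℓ = 1 := by rw [← mul_pow]; norm_num
  rw [h8]
  calc (ℓ : ℝ) ^ 2 * ((1 / 2 : ℝ) ^ ℓ * (1 / 4 : ℝ) ^ ℓ) ≤ (2 * 2 ^ ℓ) * ((1 / 2 : ℝ) ^ ℓ * (1 / 4 : ℝ) ^ ℓ) :=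
        mul_le_mul_of_nonneg_right h (by positivity)
    _ = 2 * (2 ^ ℓ * (1 / 2 : ℝ) ^ ℓ) * (1 / 4 : ℝ) ^ ℓ := by ring
    _ = 2 * (1 / 4 : ℝ) ^ ℓ := by rw [h2, mul_one]

/-! ### The bookkeeping inequality -/

/-- **Octave-loss bookkeeping.** If `c₁ ≤ κ·(θ/n)·(1 + 56 n S + 24216 n² θ)` (the DCP lower bound at scale `2n` with the
denominator bounded by head sum `S` and tail), `κ ≤ 2^{-ℓ}`, `θ ≤ 4Cℓ 2^{-ℓ}`, `S ≤ 6Cb`, `b ≤ 2n/ℓ`, `1 ≤ ℓ`, then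
`c₁ ≤ C/n + 777600·C²·n·4^{-ℓ}`. [folklore] -/
theorem octave_loss_arith {c₁ C κ θ S b n : ℝ} {ℓ : ℕ} (hC : 0 < C) (hn : 1 ≤ n) (hℓ : 1 ≤ ℓ)
    (hκ : κ ≤ (1 / 2 : ℝ) ^ ℓ) (hθ0 : 0 ≤ θ) (hθ : θ ≤ 4 * C * ℓ * (1 / 2 : ℝ) ^ ℓ)
    (hS0 : 0 ≤ S) (hS : S ≤ 6 * C * b) (hb : b ≤ 2 * n / ℓ)
    (hmain : c₁ ≤ κ * (θ / n) * (1 + 56 * n * S + 24216 * n ^ 2 * θ)) :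
    c₁ ≤ C / n + 777600 * C ^ 2 * n * (1 / 4 : ℝ) ^ ℓ := by
  have hn0 : 0 < n := by linarith
  have hℓ0 : (0 : ℝ) < ℓ := by exact_mod_cast (show 0 < ℓ by omega)
  have hh : (0 : ℝ) ≤ (1 / 2 : ℝ) ^ ℓ := by positivity
  have hq4 : (1 / 4 : ℝ) ^ ℓ = (1 / 2 : ℝ) ^ ℓ * (1 / 2 : ℝ) ^ ℓ := by rw [← mul_pow]; norm_num
  have hq8 : (1 / 8 : ℝ) ^ ℓ = (1 / 2 : ℝ) ^ ℓ * (1 / 2 : ℝ) ^ ℓ * (1 / 2 : ℝ) ^ ℓ := by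
    rw [← mul_pow, ← mul_pow]; norm_num
  -- `κ θ ≤ 4 C ℓ (1/4)^ℓ`, `κ θ² ≤ 16 C² ℓ² (1/8)^ℓ`
  have hκθ : κ * θ ≤ 4 * C * ℓ * (1 / 4 : ℝ) ^ ℓ := by
    rw [hq4]
    calc κ * θ ≤ (1 / 2 : ℝ) ^ ℓ * (4 * C * ℓ * (1 / 2 : ℝ) ^ ℓ) := mul_le_mul hκ hθ hθ0 hh
      _ = 4 * C * ℓ * ((1 / 2 : ℝ) ^ ℓ * (1 / 2 : ℝ) ^ ℓ) := by ring
  have hκθθ : κ * θ * θ ≤ 16 * C ^ 2 * ℓ ^ 2 * (1 / 8 : ℝ) ^ ℓ := by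
    rw [hq8]
    calc κ * θ * θ ≤ (4 * C * ℓ * (1 / 4 : ℝ) ^ ℓ) * (4 * C * ℓ * (1 / 2 : ℝ) ^ ℓ) :=
          mul_le_mul hκθ hθ hθ0 (by positivity)
      _ = 16 * C ^ 2 * ℓ ^ 2 * ((1 / 2 : ℝ) ^ ℓ * (1 / 2 : ℝ) ^ ℓ * (1 / 2 : ℝ) ^ ℓ) := by rw [hq4]; ring
  -- expand the main bound into three terms
  have hexp : κ * (θ / n) * (1 + 56 * n * S + 24216 * n ^ 2 * θ) =
      κ * θ / n + 56 * (κ * θ) * S + 24216 * (κ * θ * θ) * n := by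
    field_simp
  rw [hexp] at hmain
  -- term 1: `κ θ / n ≤ 4 C ℓ (1/4)^ℓ / n ≤ C / n` (`ℓ (1/4)^ℓ ≤ (1/2)^ℓ ≤ 1/2 ≤ 1/4·…` — use `ℓ 4^{-ℓ} ≤ 1/4`)
  have hl4 : (ℓ : ℝ) * (1 / 4 : ℝ) ^ ℓ ≤ 1 / 4 := by
    -- `ℓ (1/4)^ℓ ≤ (1/2)^ℓ · (ℓ (1/2)^ℓ)`… simplest: `ℓ (1/4)^ℓ ≤ (1/2)^ℓ ≤ 1/2`, and for the constant `1/4` use `ℓ ≥ 1`: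
    -- `(1/2)^ℓ ≤ 1/2`; but we need `1/4`: use `ℓ (1/4)^ℓ = (ℓ (1/2)^ℓ) (1/2)^ℓ ≤ 1 · …`; `ℓ (1/2)^ℓ ≤ 1`? (`ℓ ≤ 2^ℓ`) yes.
    have h1 : (ℓ : ℝ) * (1 / 2 : ℝ) ^ ℓ ≤ 1 := by
      have h : (ℓ : ℝ) ≤ 2 ^ ℓ := by exact_mod_cast (Nat.lt_two_pow_self (n := ℓ)).le
      have h2 : (2 : ℝ) ^ ℓ * (1 / 2 : ℝ) ^ ℓ = 1 := by rw [← mul_pow]; norm_num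
      calc (ℓ : ℝ) * (1 / 2 : ℝ) ^ ℓ ≤ 2 ^ ℓ * (1 / 2 : ℝ) ^ ℓ := mul_le_mul_of_nonneg_right h hh
        _ = 1 := h2
    have h2 : (1 / 2 : ℝ) ^ ℓ ≤ 1 / 4 ∨ ℓ = 1 := by
      rcases Nat.lt_or_ge ℓ 2 with h | h
      · right; omega
      · left
        calc (1 / 2 : ℝ) ^ ℓ ≤ (1 / 2 : ℝ) ^ 2 := pow_le_pow_of_le_one (by norm_num) (by norm_num) h
          _ = 1 / 4 := by norm_num
    rcases h2 with h2 | rfl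
    · rw [hq4]
      calc (ℓ : ℝ) * ((1 / 2 : ℝ) ^ ℓ * (1 / 2 : ℝ) ^ ℓ) = ((ℓ : ℝ) * (1 / 2 : ℝ) ^ ℓ) * (1 / 2 : ℝ) ^ ℓ := by ring
        _ ≤ 1 * (1 / 4) := mul_le_mul h1 h2 hh (by norm_num)
        _ = 1 / 4 := one_mul _
    · norm_num
  have ht1 : κ * θ / n ≤ C / n := by
    rw [div_le_div_iff_of_pos_right hn0]
    calc κ * θ ≤ 4 * C * ℓ * (1 / 4 : ℝ) ^ ℓ := hκθ
      _ = 4 * C * ((ℓ : ℝ) * (1 / 4 : ℝ) ^ ℓ) := by ring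
      _ ≤ 4 * C * (1 / 4) := mul_le_mul_of_nonneg_left hl4 (by positivity)
      _ = C := by ring
  -- term 2: `56 κθ S ≤ 56 · 4Cℓ(1/4)^ℓ · 6 C b ≤ 56·4·6·2 C² n (1/4)^ℓ = 2688 C² n (1/4)^ℓ`
  have ht2 : 56 * (κ * θ) * S ≤ 2688 * C ^ 2 * n * (1 / 4 : ℝ) ^ ℓ := by
    have hbS : S ≤ 6 * C * (2 * n / ℓ) := hS.trans (mul_le_mul_of_nonneg_left hb (by positivity))
    calc 56 * (κ * θ) * S ≤ 56 * (4 * C * ℓ * (1 / 4 : ℝ) ^ ℓ) * (6 * C * (2 * n / ℓ)) :=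
          mul_le_mul (mul_le_mul_of_nonneg_left hκθ (by norm_num)) hbS hS0 (by positivity)
      _ = 2688 * C ^ 2 * n * (1 / 4 : ℝ) ^ ℓ := by field_simp; ring
  -- term 3: `24216 κθ² n ≤ 24216·16 C² ℓ² (1/8)^ℓ n ≤ 24216·32 C² n (1/4)^ℓ`
  have ht3 : 24216 * (κ * θ * θ) * n ≤ 774912 * C ^ 2 * n * (1 / 4 : ℝ) ^ ℓ := by
    have h := sq_mul_eighth_pow_le ℓ
    calc 24216 * (κ * θ * θ) * n ≤ 24216 * (16 * C ^ 2 * ℓ ^ 2 * (1 / 8 : ℝ) ^ ℓ) * n :=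
          mul_le_mul_of_nonneg_right (mul_le_mul_of_nonneg_left hκθθ (by norm_num)) hn0.le
      _ = 24216 * 16 * C ^ 2 * n * ((ℓ : ℝ) ^ 2 * (1 / 8 : ℝ) ^ ℓ) := by ring
      _ ≤ 24216 * 16 * C ^ 2 * n * (2 * (1 / 4 : ℝ) ^ ℓ) := mul_le_mul_of_nonneg_left h (by positivity)
      _ = 774912 * C ^ 2 * n * (1 / 4 : ℝ) ^ ℓ := by ring
  linarith

/-! ### The abstract octave-loss bound -/

/-- **Abstract octave-loss bound.** For `G > 0` nonincreasing with nondecreasing shifted ratios, level envelope `k G(k) ≤ C`,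
the descending iteration and the head-sum bound (tree lemmas `logConvex_descend`, `logConvex_head_sum`, taken as hypotheses),
a lower bound of Duminil-Copin–Panis type `c₁ ≤ G(2n)(1 + 56 n Σ_{k≤n} k G(k) + 24216 n³ G(n))` at a scale `n ≥ 2C/c₁` with an
`ℓ`-octave loss `G(2n) ≤ 2^{-ℓ} G(n)` (`ℓ ≥ 1`, `4ℓ ≤ ⌊n/ℓ⌋`) forces `4^ℓ ≤ (1555200 C²/c₁)·n`. [folklore] -/
theorem four_pow_le_of_octave_loss (hpos : ∀ n, 0 < G n) (hmono : Monotone fun k => G (k + 2) / G (k + 1))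
    (hanti : ∀ k, G (k + 1) ≤ G k) {C c₁ : ℝ} (hC : 0 < C) (hc₁ : 0 < c₁)
    (henv : ∀ k : ℕ, 1 ≤ k → (k : ℝ) * G k ≤ C)
    (hdesc : ∀ n k s : ℕ, 1 ≤ k → k + s ≤ n → G (k + s) ≤ (G (n + 1) / G n) ^ s * G k)
    (hhead : ∀ (b n : ℕ), 1 ≤ b →
      (∀ k j : ℕ, 1 ≤ k → k + j * b ≤ n → G (k + j * b) ≤ (1 / 2 : ℝ) ^ j * G k) →
      ∑ k ∈ Icc 1 n, (k : ℝ) * G k ≤ 6 * C * b)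
    {n ℓ : ℕ} (hn : 1 ≤ n) (hnC : 2 * C / c₁ ≤ n) (hℓ : 1 ≤ ℓ) (h4ℓ : 4 * ℓ ≤ n / ℓ)
    (hloss : G (2 * n) ≤ (1 / 2 : ℝ) ^ ℓ * G n)
    (hDCP : c₁ ≤ G (2 * n) * (1 + 56 * n * (∑ k ∈ Icc 1 n, (k : ℝ) * G k) + 24216 * (n : ℝ) ^ 3 * G n)) :
    (4 : ℝ) ^ ℓ ≤ 1555200 * C ^ 2 / c₁ * n := by
  have hn0 : (0 : ℝ) < n := by exact_mod_cast hn
  have hℓ0 : ℓ ≠ 0 := by omega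
  have hℓn : ℓ ≤ n := by
    have h := (Nat.le_div_iff_mul_le (by omega)).1 h4ℓ
    have h1 : ℓ ≤ 4 * ℓ * ℓ := by
      calc ℓ = 1 * ℓ * 1 := by ring
        _ ≤ 4 * ℓ * ℓ := Nat.mul_le_mul (Nat.mul_le_mul (by norm_num) le_rfl) hℓ
    exact h1.trans h
  -- block length `b = ⌊n/ℓ⌋ + 1`, `bℓ ≥ n`
  set b : ℕ := n / ℓ + 1 with hb
  have hbℓ : n ≤ b * ℓ := by
    have h := Nat.lt_mul_div_succ n (show 0 < ℓ by omega)
    rw [hb, Nat.mul_comm]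
    exact h.le
  have hhalf := block_halving hpos hmono hanti hn hℓ0 hbℓ hloss (hdesc n)
  -- level, head sum, block length as a real
  have hθ : (n : ℝ) * G n ≤ 4 * C * ℓ * (1 / 2 : ℝ) ^ ℓ :=
    level_le_of_octave_loss_abstract hpos henv hℓ h4ℓ hhalf
  have hS : ∑ k ∈ Icc 1 n, (k : ℝ) * G k ≤ 6 * C * b := hhead b n (by omega) hhalf
  have hS0 : 0 ≤ ∑ k ∈ Icc 1 n, (k : ℝ) * G k :=
    Finset.sum_nonneg fun k _ => mul_nonneg (by positivity) (hpos k).le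
  have hb_real : (b : ℝ) ≤ 2 * n / ℓ := by
    have hℓ0' : (0 : ℝ) < ℓ := by exact_mod_cast (show 0 < ℓ by omega)
    rw [le_div_iff₀ hℓ0']
    have h1 : ((n / ℓ : ℕ) : ℝ) * ℓ ≤ n := by exact_mod_cast Nat.div_mul_le_self n ℓ
    have h2 : (ℓ : ℝ) ≤ n := by exact_mod_cast hℓn
    have h3 : (b : ℝ) * ℓ = ((n / ℓ : ℕ) : ℝ) * ℓ + ℓ := by rw [hb]; push_cast; ring
    rw [h3]
    linarith
  -- bookkeeping
  have hmain : c₁ ≤ G (2 * n) / G n * ((n : ℝ) * G n / n) *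
      (1 + 56 * n * (∑ k ∈ Icc 1 n, (k : ℝ) * G k) + 24216 * (n : ℝ) ^ 2 * ((n : ℝ) * G n)) := by
    have e1 : G (2 * n) / G n * ((n : ℝ) * G n / n) = G (2 * n) := by
      have h1 : G n ≠ 0 := (hpos n).ne'
      have h2 : (n : ℝ) ≠ 0 := hn0.ne'
      calc G (2 * n) / G n * ((n : ℝ) * G n / n) = G (2 * n) * (G n / G n) * ((n : ℝ) / n) := by ring
        _ = G (2 * n) := by rw [div_self h1, div_self h2]; ring
    rw [e1]
    calc c₁ ≤ _ := hDCP
      _ = _ := by ring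
  have hκle : G (2 * n) / G n ≤ (1 / 2 : ℝ) ^ ℓ := (div_le_iff₀ (hpos n)).2 hloss
  have harith := octave_loss_arith (c₁ := c₁) hC (by exact_mod_cast hn) hℓ hκle
    (mul_nonneg hn0.le (hpos n).le) hθ hS0 hS hb_real hmain
  -- `4^ℓ ≤ K n`
  have hCn : C / n ≤ c₁ / 2 := by
    rw [div_le_iff₀ hn0]
    have := (div_le_iff₀ hc₁).1 hnC
    linarith
  have h1 : c₁ / 2 ≤ 777600 * C ^ 2 * n * (1 / 4 : ℝ) ^ ℓ := by linarith
  have h14 : (1 / 4 : ℝ) ^ ℓ * 4 ^ ℓ = 1 := by rw [← mul_pow]; norm_num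
  have h2 : c₁ / 2 * (4 : ℝ) ^ ℓ ≤ 777600 * C ^ 2 * n := by
    calc c₁ / 2 * (4 : ℝ) ^ ℓ ≤ (777600 * C ^ 2 * n * (1 / 4 : ℝ) ^ ℓ) * 4 ^ ℓ :=
          mul_le_mul_of_nonneg_right h1 (by positivity)
      _ = 777600 * C ^ 2 * n * ((1 / 4 : ℝ) ^ ℓ * 4 ^ ℓ) := by ring
      _ = 777600 * C ^ 2 * n := by rw [h14, mul_one]
  rw [div_mul_eq_mul_div, le_div_iff₀ hc₁]
  nlinarith [h2]

end Funnel.LogConvexSeq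

namespace FoldedCurrentRepulsion

open Literature.Probability.LatticeModels

/-- **Registered sub-goal `level_le_of_octave_loss`** (the critical axis function of `ℤ³`): for the level envelope constant
`C` of the infrared bound (`k·g(k) ≤ C`), every octave-loss scale is exponentially light — if `g(2n) ≤ 2^{-ℓ} g(n)` with
`ℓ ≥ 1`, `4ℓ ≤ ⌊n/ℓ⌋`, and the descending iteration below `n` holds (hypothesis `hdesc`, = tree lemma `logConvex_descend`
specialised), then `n·g(n) ≤ 4Cℓ 2^{-ℓ}`. Reflection positivity only (log-convexity `criticalTwoPoint_axis_ratio_mono`,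
monotonicity `criticalTwoPoint_axis_succ_le`). [cite: AizenmanDuminilCopinAnnals2021, arXiv:1912.07973 Prop. 5.3 (5.17) and §5.5 (p. 19)] -/
theorem level_le_of_octave_loss : ∀ (C : ℝ) (n ℓ : ℕ), (∀ k : ℕ, 1 ≤ k → (k : ℝ) * criticalTwoPoint 3 (Pi.single 0 (k : ℤ)) ≤ C) → 1 ≤ ℓ → 4 * ℓ ≤ n / ℓ → criticalTwoPoint 3 (Pi.single 0 ((2 * n : ℕ) : ℤ)) ≤ (1 / 2 : ℝ) ^ ℓ * criticalTwoPoint 3 (Pi.single 0 (n : ℤ)) → (∀ k s : ℕ, 1 ≤ k → k + s ≤ n → criticalTwoPoint 3 (Pi.single 0 ((k + s : ℕ) : ℤ)) ≤ (criticalTwoPoint 3 (Pi.single 0 ((n + 1 : ℕ) : ℤ)) / criticalTwoPoint 3 (Pi.single 0 (n : ℤ))) ^ s * criticalTwoPoint 3 (Pi.single 0 (k : ℤ))) → (n : ℝ) * criticalTwoPoint 3 (Pi.single 0 (n : ℤ)) ≤ 4 * C * ℓ * (1 / 2 : ℝ) ^ ℓ := by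
  intro C n ℓ henv hℓ hq hloss hdesc
  set G : ℕ → ℝ := fun m => criticalTwoPoint 3 (Pi.single 0 (m : ℤ)) with hG
  have hpos : ∀ m, 0 < G m := Funnel.criticalTwoPoint_axis_pos 0
  have hmono : Monotone fun k => G (k + 2) / G (k + 1) := criticalTwoPoint_axis_ratio_mono 0
  have hanti : ∀ k, G (k + 1) ≤ G k := fun k =>
    Funnel.criticalTwoPoint_axis_antitone 0 (Nat.le_succ k)
  have hn : 1 ≤ n := by
    by_contra h
    push Not at h
    have : n = 0 := by omega
    subst this
    simp at hq
    omega
  have hℓ0 : ℓ ≠ 0 := by omega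
  have hb : n ≤ (n / ℓ + 1) * ℓ := by
    have := Nat.div_add_mod n ℓ
    have hm := Nat.mod_lt n (show 0 < ℓ by omega)
    nlinarith [Nat.mul_comm ℓ (n / ℓ)]
  have hhalf := Funnel.LogConvexSeq.block_halving (G := G) hpos hmono hanti hn hℓ0 hb hloss hdesc
  exact Funnel.LogConvexSeq.level_le_of_octave_loss_abstract (G := G) hpos henv hℓ hq hhalf

end FoldedCurrentRepulsion

end Summit.CriticalPhenomena.Ising3DConformalLimit.Cruxes.ExistsScaleCovariantLimit

end
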